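import Literature.MathematicalPhysics.QuantumFieldTheory.Balaban1983to89.Node00.TkFullBondTransport
import Literature.MathematicalPhysics.QuantumFieldTheory.Balaban1983to89.Node00.Record12

/-!
# NODE 00 — THE NO-EXPANSION 𝐓-SLOT OF RECORD AT LEVEL 1, UNFOLDED: `𝐓_1(s′) exp A_1(s′)` at the all-large-field new sequence
# (`Ω₁(s′) = Λ₁(s′) = ∅`) as ONE restricted kernel transport of an explicit integrand, its a.e. face as def-T's transport of record,
# the background of record there (= the fine field), and N11's first residue (S1ᵀ)_0 there as an EQUATION BETWEEN TWO TRANSPORTS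

Cell `pub-ymgap`, YM-PLAN Track A (HUMAN RULING D-0062); author seat `pub-ymgap-dag-n11-d` (g3; R134 fan-out seat N11 [B14], strategy s2), lineage
item K1′ `StabilityBAtRecordR12e` = stmt-QuantumFields-19903.  Sequel of this seat's `Node00.TkFullBondTransport` (g2: the full-bond-set face
`kernelRTOfRecord_full_ae_eq_transportOfRecord` and the no-expansion generation `genOp_genDataOfRecord_of_Omega_empty`), over def-T's 11a `Node00.TkOfRecord`
(`𝐓_k(s)` of (2.18)–(2.22)), 12a `Node00.TkWeightsOfRecord` (the 𝐓-weights of record `ζ = ζ0·χreg`, `chiA`, residual `quad`), FILE 1 `Node00.TStepOfRecord`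
(the T-step (†) (3.1), `transportOfRecord`), 12b `Node00.Record12` (`TLaw₁₂`, the repaired §2 dichotomy) and def-R's FILE 16 `Node00.LargeFieldBackgroundMSOfRecord`
(the multi-scale background `UbgMSOfRecord`).  [III] = [Balaban1988Convergent], [6] = [Balaban1985RegularSpaces], [15] = [Balaban1985Variational].

WHY.  Node N11's residue at the Stage-12 record is (S1ᵀ) «`∀ k < K, SLaw₁₂ θ P k → TLaw₁₂ θ P k`» ([III] Theorem p. 245 at the objects of record; this
seat's `BalabanUVNodesN11AtRecord12C`, `…N11FirstSlotAtRecord12`).  Its first instance is `TLaw₁₂ θ P 0`: the 𝐓-image of `ρ₀` has the §2 form at level 1.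
Among the new sequences `s′` of length 1 there is exactly one WITHOUT SMALL-FIELD REGION — `Ω₁(s′) = ∅` (hence `Λ₁(s′) = ∅`: every cube of `V₁` large-field)
— where print performs NO background-field expansion and creates NO new terms ((2.22), p. 258: *«the same without the A-integral»*): there `𝐓_1(s′) = 𝐓^{(0)}`
is ONE δ-constrained `V₀`-integration with the weight `ζ_0(Ω₁ᶜ) = ζ_0(T)`.  This file UNFOLDS both sides of the (3.25) identity demanded by `TLaw₁₂ θ P 0` at that
sequence down to the tree's kernels and residual letters, so that what (S1ᵀ)_0 asks of a K1′ witness there is an explicit EQUATION: def-T's transport of the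
step-weighted Wilson start `w(s′)(U,V₁)·ρ₀(U)` against def-T's transport of `ζ0_0(T)·χreg_0(T)·e^{−½quad_0(∅)}·exp A_1(s′)(U_1)` read at `(V₀,V₁) = (U,V₁)` —
and identifies the background `U_1` of record there with the fine field `U` itself (print's `U₁ = V₀` on `Γ₀ = T`).  The reading was announced by g2 on the
cell's bus (pub-ymgap INBOX l.14524); here it is kernel-checked.

WHAT THIS FILE PROVES (0 `sorry`, 0 `instance`, 0 `notation`; 2 `def`s = two named readings; `N`-generic).
§1 GENERIC 11a (`TkWeights` arbitrary).  `Tk.pairCfg V₁ U` = the two-scale configuration `(V₀,V₁) := (U,V₁)`, fluctuation fields `0`, unit gauge variables above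
   (11a's `baseCfg 1 V₁` updated at scale `0`; faces `pairCfg_zero∕_one_fst∕_snd`, `update_baseCfg_one_eq_pairCfg`); `noExpIntegrand W Φ V₁ U` =
   `ζ_0(T)·w_0(∅,∅,∅)·Φ(∅-branch)` at `pairCfg V₁ U`; `chiSeqOfRecord_eq_one_of_Omega_empty` (`χ_k(∅) ≡ 1`); **`TkOfRecord_one_eq_genOp_of_Omega_empty`**
   (`𝐓_1(s′) = 𝐓^{(0)}`: the `{S_j}`-index is the all-empty branch, `TkOfRecord_of_eq`; 11a's classical `DecidableEq` instance bridged by `Subsingleton.elim`) and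
   **`TkOfRecord_one_eq_kernelRT_of_Omega_empty`**: `(𝐓_1(s′)Φ)(V₁) = kernelRTOfRecord K 0 sV sV′ [y ↦ noExpIntegrand W Φ V₁ (1 updated by y)] (V₁|sV′)` — POINTWISE.
§2 12a's WEIGHTS AT THE EMPTY REGIONS.  `cubesIn_cubeχ_empty`, `chiSmallAW_empty`∕`chiLargeAW_empty`∕`chiPrimeW_empty` (empty products), `chiAW_empty_empty`
   (`χ(∅,∅) = 1`), **`w_tkWeightsOfRecord_empty`**: the A-weight of the empty A-bond set is `e^{−½·quad_j(∅)(ω)}` — LOCATED TYPING CORNER (said, nothing asserted):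
   print has no factor at all here ((2.22)), while the residual `quad` of 11a∕12a carries no law «`quad_j(Λ′)(ω)` is a quadratic form in `(ω j).2` vanishing at
   `A_j = 0`»; at a witness whose `quad` IS [I]'s form the factor is `1`; `noExpIntegrand_tkWeightsOfRecord` (the integrand at 12a's weights:
   `ζ0_0(T)·χreg_0(T)·e^{−½quad_0(∅)}·Φ`), `chiRegW_zero_pairCfg` (the regularity factor reads only `U`), `zeta0_zero_pairCfg_eq_of_localLaws` (under 12b's
   locality law `ζ0_0` does not see `V₁`).
§3 MEASURE THEORY.  **`transportK_congr_ae_of_fibre`** (generic gauge group, any measurable averaging with `HaarAC`): two integrand families agreeing ON THE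
   GRAPH `V = Ū` have `dV`-a.e. equal one-step kernel transports (`avgKernel_fibre_ae` through `withDensity_margDensity`; no integrability needed — the
   SUFFICIENCY of a fibre identity; the converse is false); **`TkOfRecord_one_ae_eq_transportOfRecord_of_Omega_empty`**: for `0 < K` and a jointly measurable,
   bounded no-expansion integrand family (DISPLAYED provisos, as def-T's `TStepProvisos.measW`∕`absW_le` — the residual readings are not measurable by
   construction), `𝐓_1(s′)Φ =ᵐ [V₁ ↦ transportOfRecord K 0 (noExpIntegrand W Φ V₁) V₁]` (g2's face on the full bond sets).
§4 AT THE STAGE-12 RECORD (`θ` generic, run `p`, `s′ : SeqOfRecord … p.K 1` with `s′.Ω 1 = ∅`).  `slotsTOfRecord_one_apply` (def-T's pre-𝐑 slot at level 1,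
   EVERY `s′`: `slotT_1(s′)(V₁) = transportOfRecord p.K 0 [U ↦ w(s′)(U,V₁)·ρ₀(U)] V₁`, `χ₀ ≡ 1`); `noExpIntegrand_WtOfRecord₁₂_sect2Operand` (the integrand at
   the 𝐓-weights of record and the §2 operand, explicit); `sect2Slot_one_eq_kernelRT_of_Omega_empty` (pointwise) ∕ `sect2Slot_one_ae_eq_transport_of_Omega_empty`
   (a.e.); **`tLaw₁₂_zero_clause_of_Omega_empty`** (`TLaw₁₂ θ p 0` ⇒ its witness `(t, E_1)` satisfies at `s′` the GUARD-FREE dichotomy «`slotT_1(s′) = 0` or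
   `slotT_1(s′) = 𝐓_1(s′)e^{A_1(s′)}` `dV₁`-a.e.» — `χ_1(s′) ≡ 1`); **`tLaw₁₂_zero_coherence_of_Omega_empty`** (THE NO-EXPANSION COHERENCE EQUATION: under the
   displayed provisos, either `slotT_1(s′) ≡ 0` or the two transports of record agree a.e.); **`slotsT_one_ae_eq_sect2Slot_of_fibre_identity`** ∕
   `hasSect2FormAtZ_clause_one_of_fibre_identity` (CONVERSELY, for a witness builder: the fibre identity of integrands `w(s′)(U,Ū)·ρ₀(U) = noExpIntegrand (Ū, U)`
   for every `U` DISCHARGES the identity branch of 12b's dichotomy at `s′`).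
§5 THE BACKGROUND OF RECORD AT THE ALL-LARGE-FIELD SEQUENCE IS THE FINE FIELD.  `agreeOn_genSet_one_iff_of_Omega_empty` ((2.2) at `Ω₁ = ∅`: `𝐁 = {Γ₀ = T}`,
   agreement = `U = 𝐖 0`), `isMinimizer_genSet_one_iff_of_Omega_empty` (a (2.12) minimiser there IS `𝐖 0`, existing iff `𝐖 0` is in the class),
   `mem_regMSOfRecord_one_iff_of_Omega_empty` ([6] (1.7) there = global `ε₀`-regularity), **`UbgMSOfRecord_one_of_Omega_empty`** ∕ `UbgOfRecord₁₂_one_of_Omega_empty`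
   (`U_1(s′)(𝐖) = 𝐖 0` for `ε₀`-regular `𝐖 0` — def-R's classical-choice minimiser is FORCED by the constraint; junk `1` otherwise: `…_of_not`),
   `UbgOfRecord₁₂_one_pairCfg_of_Omega_empty` (at `(U,V₁)`: the background is `U`), `plaqSmall_of_chiRegW_zero_univ_ne_zero` (the LETTERS' JUNCTION, located:
   on the support of `χreg_0(T)` the fine field is in print's class whenever `cR·ε₀ ≤ ε₀^{reg}·η₀²` — def-R's letter `cR` of (2.10) against the class radius of (2.12)),
   `noExpIntegrand_WtOfRecord₁₂_sect2Operand_of_regular` ∕ `…_of_chiRegW_ne_zero` (the right-hand integrand with the background RESOLVED: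
   `ζ0_0(T)·χreg_0(T)·e^{−½quad_0(∅)}·exp A_1(s′)(U)`), `noExpIntegrand_WtOfRecord₁₂_eq_zero_of_chiRegW_eq_zero` (it vanishes off the regular set).

WHAT IT GIVES THE K1′ WITNESS ∕ 12a–12b's pens (readings, not claims).  (i) At its first no-expansion step (S1ᵀ) demands of `θ.Zt` EXACTLY:
`∫dU δ(ŪV₁⁻¹) w(s′)(U,V₁)ρ₀(U) = ∫dU δ(ŪV₁⁻¹) 𝟙{U cR·ε₀-regular}·ζ0_0(T)(U)·e^{−½quad_0(∅)(U)}·e^{A_1(s′)(U)}` a.e. (or `slotT_1(s′) ≡ 0`), and the fibre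
identity of the integrands suffices; by locality `ζ0_0(T)` reads only `U`, on the fibre `V₁ = Ū` is a function of `U`, so the `V₁`-dependence of the step weights
(the (3.2) indicators of `V₁`) IS expressible — the equation is satisfiable inside `ztLocal`.  (ii) It is NOT an identity 11a∕12a∕12b prove: `w` (def-T's
resummed (3.2)·(3.3)·ζ-labels of record) and `ζ0` (12a's residual) are independent residual data; a tuple whose `ζ0_0(T)` ignores the large-field indicators that
`w(s′)` carries (e.g. a `ζ0` constant in `ω`) can meet it only if the zero-term action bookkeeping absorbs an indicator — the located consequence g2 drew for
the K0′ inhabitant of record (bus l.14524 (ii)); this file does not decide it (no measurable selection of def-R's minimiser, no positivity-of-measure facts about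
the (3.2) regions are in the tree).

HONEST SCOPE.  Kernel bookkeeping on the tree's OWN objects; every identity is PROVED by unfolding, the two measure-theoretic faces from displayed hypotheses.
Nothing of Bałaban's is asserted: Theorem p. 245, Thms 1–2 [III], (3.6)–(3.25), [6], [15] Thm 1 are what would make the displayed equation TRUE at the objects of
a correct witness.  N11 is NOT discharged; no node count moves (typed 28∕28 · discharged 5∕28).  One finite four-torus programme at fixed `ε = L^{−K}`, Bałaban AS
PRINTED with locators; NOT ℝ⁴, NOT infinite volume, NOT OS, NOT a mass gap, NOT the Clay problem.  Sources: [III] (2.1)–(2.2) pp. 254–255, (2.10)–(2.13)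
pp. 256–257, (2.17)–(2.18) p. 257, (2.20)–(2.23) p. 258, Thm 1 p. 262, (3.1)–(3.3) pp. 264–265, (3.16)–(3.21) pp. 268–269, (3.23)–(3.25) p. 270, Theorem p. 245;
[6] (1.7) p. 77; [15] (6), Thm 1 (8) pp. 278–279; [Balaban1985Averaging] (10) p. 19.
-/

noncomputable section

open MeasureTheory
open scoped Matrix.Norms.L2Operator

namespace Literature.MathematicalPhysics.QuantumFieldTheory.Balaban1983to89.Node00

open T4AveragingDisintegration T4Continuum T4FiniteEpsInhabited Tk B14.Eq218Concrete

/-! ## §1  Generic 11a: the two-scale configuration, the no-expansion integrand, `𝐓_1(s′)` at `Ω₁(s′) = ∅` unfolded -/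

section Generic

variable {P : Params} {G V : Type} [One G] [Zero V]

/-- The base configuration reads the level-`k` field at scale `k` (bookkeeping on 11a's `baseCfg`). [cite: Balaban1988Convergent, (2.18) p.257 (bookkeeping)] -/
theorem Tk.baseCfg_fst_self (k : ℕ) (Vk : GaugeField P k G) (b : PBond P k) : ((baseCfg (V := V) k Vk) k).1 b = Vk b := by
  simp [baseCfg]

/-- … and the unit configuration at every other scale. [cite: Balaban1988Convergent, (2.18) p.257 (bookkeeping)] -/
theorem Tk.baseCfg_fst_of_ne {j k : ℕ} (h : j ≠ k) (Vk : GaugeField P k G) : ((baseCfg (V := V) k Vk) j).1 = fun _ => 1 := by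
  funext b
  simp [baseCfg, h]

/-- **THE TWO-SCALE CONFIGURATION `(V₀, V₁) := (U, V₁)`** with zero fluctuation variables and unit gauge variables above scale `1`: the all-scales
configuration at which the ONE generation of `𝐓_1` reads its weights and its operand (11a's `baseCfg 1 V₁` with the scale-`0` variables set to the
integrated fine field `U`). [cite: Balaban1988Convergent, (2.21) p.258, (2.18) p.257] -/
def Tk.pairCfg (V1 : GaugeField P 1 G) (U : GaugeField P 0 G) : MultiCfg P G V :=
  Function.update (baseCfg 1 V1) 0 (U, 0)

/-- Scale `0` of the two-scale configuration is `(U, 0)`. [cite: Balaban1988Convergent, (2.21) p.258 (bookkeeping)] -/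
@[simp] theorem Tk.pairCfg_zero (V1 : GaugeField P 1 G) (U : GaugeField P 0 G) : pairCfg (V := V) V1 U 0 = (U, 0) :=
  Function.update_self _ _ _

/-- Above scale `0` the two-scale configuration is the base configuration of `V₁`. [cite: Balaban1988Convergent, (2.18) p.257 (bookkeeping)] -/
theorem Tk.pairCfg_of_ne_zero (V1 : GaugeField P 1 G) (U : GaugeField P 0 G) {j : ℕ} (hj : j ≠ 0) :
    pairCfg (V := V) V1 U j = baseCfg 1 V1 j :=
  Function.update_of_ne hj _ _

/-- Scale `1` of the two-scale configuration reads `V₁`. [cite: Balaban1988Convergent, (2.18) p.257 (bookkeeping)] -/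
@[simp] theorem Tk.pairCfg_one_fst (V1 : GaugeField P 1 G) (U : GaugeField P 0 G) : (pairCfg (V := V) V1 U 1).1 = V1 := by
  funext b
  rw [pairCfg_of_ne_zero V1 U one_ne_zero]
  exact baseCfg_fst_self (V := V) 1 V1 b

/-- The fluctuation variables of the two-scale configuration vanish at every scale. [cite: Balaban1988Convergent, (2.21) p.258 (bookkeeping)] -/
@[simp] theorem Tk.pairCfg_snd (V1 : GaugeField P 1 G) (U : GaugeField P 0 G) (j : ℕ) : (pairCfg (V := V) V1 U j).2 = 0 := by
  by_cases hj : j = 0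
  · subst hj; rw [pairCfg_zero]
  · rw [pairCfg_of_ne_zero V1 U hj, baseCfg_snd]

/-- The configuration at which 11a's V-factor (`vOp_apply`) evaluates the generation-`0` integrand when acting on `baseCfg 1 V₁` IS the two-scale
configuration of the updated fine variables. [cite: Balaban1988Convergent, (2.21) p.258 (bookkeeping)] -/
theorem Tk.update_baseCfg_one_eq_pairCfg [DecidableEq (PBond P 0)] (V1 : GaugeField P 1 G) (sV : Finset (PBond P 0)) (y : ↥sV → G) :
    Function.update (baseCfg (V := V) 1 V1) 0 (Function.updateFinset ((baseCfg (V := V) 1 V1) 0).1 sV y, ((baseCfg (V := V) 1 V1) 0).2) =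
      pairCfg V1 (Function.updateFinset (fun _ => 1) sV y) := by
  rw [baseCfg_fst_of_ne (V := V) zero_ne_one, baseCfg_snd]
  rfl

/-- On a bond finset containing every bond, updating the unit field by `U|_{sV}` gives back `U`. [cite: Balaban1988Convergent, (2.21) p.258 (bookkeeping)] -/
theorem updateFinset_one_restrict_of_forall_mem {ι : Type*} [DecidableEq ι] {sV : Finset ι} (hV : ∀ b, b ∈ sV) (U : ι → G) :
    Function.updateFinset (fun _ => (1 : G)) sV (fun b : ↥sV => U b) = U := by
  funext b
  simp [Function.updateFinset_def, hV b]

end Generic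

section Sequences

variable (F : T4Family) (N : ℕ)

/-- For an admissible sequence, `Ω_j = ∅` forces `Λ_j = ∅` ((2.1): `Λ_j ⊆ Ω_j` on the window; both `∅` off it). [cite: Balaban1988Convergent, (2.1) p.254] -/
theorem seq_Λ_eq_empty_of_Ω_eq_empty {α : Type*} {D : ℕ → Set (Set α)} {k : ℕ} (s : Seq D k) {j : ℕ} (hΩ : s.Ω j = ∅) : s.Λ j = ∅ := by
  by_cases hj : 1 ≤ j ∧ j ≤ k
  · exact Set.subset_empty_iff.mp (hΩ ▸ s.chain.Λ_subset j hj.1 hj.2)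
  · exact s.Λ_off j hj

variable [NeZero N]

/-- **`χ_k(Ω_k) ≡ 1` ON A SEQUENCE WITH `Ω_k = ∅`**: def-R's front factor is the empty product (no `LM₂R_k`-cube lies in `∅`; cubes are non-empty).
[cite: Balaban1988Convergent, (2.17)–(2.18) p.257 (bookkeeping)] -/
theorem chiSeqOfRecord_eq_one_of_Omega_empty (ν : Stage7Numerics) (M : ℕ) (g : ℕ → ℝ) (K k : ℕ) (s : SeqOfRecord F ν M g K k)
    (hΩ : s.Ω k = ∅) (V : GaugeField (F.P K) k (SU N)) : chiSeqOfRecord F N ν M g K k s V = 1 := by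
  rw [chiSeqOfRecord, chi218_apply]
  apply Finset.prod_eq_one
  rintro ⟨x, hx⟩ hc
  exfalso
  rw [mem_cubesIn, hΩ, Set.subset_empty_iff] at hc
  exact (cubeEnl_zero_nonempty (F.P K) _ hx).ne_empty hc

/-- … so the front-factor family of such a level is the constant `1`. [cite: Balaban1988Convergent, (2.17)–(2.18) p.257 (bookkeeping)] -/
theorem chiSeqOfRecord_eq_one_of_Omega_empty' (ν : Stage7Numerics) (M : ℕ) (g : ℕ → ℝ) (K k : ℕ) (s : SeqOfRecord F ν M g K k)
    (hΩ : s.Ω k = ∅) : chiSeqOfRecord F N ν M g K k s = fun _ => 1 :=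
  funext (chiSeqOfRecord_eq_one_of_Omega_empty F N ν M g K k s hΩ)

end Sequences

section TkOne

variable (F : T4Family) (N : ℕ) [NeZero N] (V : Type) [NormedAddCommGroup V] [InnerProductSpace ℝ V] [FiniteDimensional ℝ V]
  [MeasurableSpace V] [BorelSpace V]

/-- **THE NO-EXPANSION INTEGRAND OF `𝐓_1`** for the weight datum `W` and the operand `Φ`, as a function of the coarse field `V₁` and the integrated fine
field `U`: `ζ_0(T)(U, V₁) · w_0(∅, ∅, ∅)(U, V₁) · Φ(∅-branch, A = 0, (V₀, V₁) = (U, V₁))` — the generation-`0` weight `ζ_0(Ω₁ᶜ) = ζ_0(T)`, the A-weight of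
the EMPTY A-bond set ((2.22): no fluctuation integral; 11a keeps the weight `χ(∅, ∅)·e^{−½ quad_0(∅)}` as a factor), the operand at the all-empty
`{S_j}`-branch, all read at the two-scale configuration. [cite: Balaban1988Convergent, (2.21)–(2.22) p.258, (2.18) p.257] -/
def noExpIntegrand (K : ℕ) (W : TkWeights F N V K) (Φ : SFluct (F.P K) V → B15DeterminingSets.MSField (F.P K) (SU N) → ℝ)
    (V1 : GaugeField (F.P K) 1 (SU N)) (U : GaugeField (F.P K) 0 (SU N)) : ℝ :=
  W.ζ 0 Set.univ (pairCfg V1 U) *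
    (W.w 0 ∅ ∅ ∅ (pairCfg V1 U) * Φ (fun _ => ∅, fun j => (pairCfg (V := V) V1 U j).2) (fun j => (pairCfg (V := V) V1 U j).1))

variable {F N V}

/-- **`𝐓_1(s′)` AT A NO-EXPANSION NEW SEQUENCE IS ITS ONE GENERATION** (`Ω₁(s′) = ∅` ⇒ `Λ₁(s′) = ∅` ⇒ the `{S_j}`-index is the all-empty branch,
`𝐓_1 = 𝐓^{(0)} 𝐓_0 = 𝐓^{(0)}`): 11a's `TkOfRecord … 1 s′ Φ` read at `V₁` is `genOp 0` of the generation data of record applied to the operand at the empty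
branch and the base configuration.  The `DecidableEq` instance of the generation data is an implicit binder, unified with 11a's classical one.
[cite: Balaban1988Convergent, (2.18) p.257, (2.20)–(2.22) p.258, (3.24) p.270] -/
theorem TkOfRecord_one_eq_genOp_of_Omega_empty (ν : Stage7Numerics) (M : ℕ) (g : ℕ → ℝ) (K : ℕ) (W : TkWeights F N V K)
    (s : SeqOfRecord F ν M g K 1) (hΩ : s.Ω 1 = ∅) (Φ : SFluct (F.P K) V → B15DeterminingSets.MSField (F.P K) (SU N) → ℝ)
    (V1 : GaugeField (F.P K) 1 (SU N)) {hdec : DecidableEq (PBond (F.P K) 0)} :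
    TkOfRecord F N V ν M g K W 1 s Φ V1 =
      genOp 0 (genDataOfRecord F N V ν M g K W s (fun _ => ∅) 0)
        (fun ω => Φ (fun _ => ∅, fun j => (ω j).2) (fun j => (ω j).1)) (baseCfg 1 V1) := by
  have hΛ : s.Λ 1 = ∅ := seq_Λ_eq_empty_of_Ω_eq_empty s hΩ
  have hs : ∀ j, 1 ≤ j → j ≤ 1 → s.Λ j = s.Ω j := fun j h1 hj => by
    obtain rfl : j = 1 := le_antisymm hj h1
    rw [hΛ, hΩ]
  rw [TkOfRecord_of_eq F N V ν M g K W 1 s hs Φ V1, tkBranchOfRecord_succ, tkBranchOfRecord_zero]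
  obtain rfl : hdec = fun a b => Classical.propDecidable (a = b) := Subsingleton.elim _ _
  rfl

/-- **THE NO-EXPANSION 𝐓-SLOT AT LEVEL 1, UNFOLDED**: at `Ω₁(s′) = ∅`, `(𝐓_1(s′) Φ)(V₁)` IS 11a's restricted kernel transport of record ON THE FULL BOND
SETS of the no-expansion integrand `y ↦ ζ_0(T)·w_0(∅,∅,∅)·Φ` at the two-scale configuration `(V₀, V₁) = (1 updated by y on sV, V₁)`, read at `V₁|sV′`
— one δ-constrained `V₀`-integration, no A-integral ((2.22)), weights and operand explicit. [cite: Balaban1988Convergent, (2.21)–(2.22) p.258, (2.18) p.257, (3.24) p.270] -/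
theorem TkOfRecord_one_eq_kernelRT_of_Omega_empty (ν : Stage7Numerics) (M : ℕ) (g : ℕ → ℝ) (K : ℕ) (W : TkWeights F N V K)
    (s : SeqOfRecord F ν M g K 1) (hΩ : s.Ω 1 = ∅) (Φ : SFluct (F.P K) V → B15DeterminingSets.MSField (F.P K) (SU N) → ℝ)
    (V1 : GaugeField (F.P K) 1 (SU N)) {hdec : DecidableEq (PBond (F.P K) 0)} :
    TkOfRecord F N V ν M g K W 1 s Φ V1 =
      kernelRTOfRecord F N K 0 (genDataOfRecord F N V ν M g K W s (fun _ => ∅) 0).sV (genDataOfRecord F N V ν M g K W s (fun _ => ∅) 0).sV'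
        (fun y => noExpIntegrand F N V K W Φ V1
          (Function.updateFinset (fun _ => 1) (genDataOfRecord F N V ν M g K W s (fun _ => ∅) 0).sV y))
        (fun b => V1 b) := by
  have hΛ : s.Λ (0 + 1) = ∅ := seq_Λ_eq_empty_of_Ω_eq_empty s hΩ
  have hΩ' : s.Ω (0 + 1) = ∅ := hΩ
  rw [TkOfRecord_one_eq_genOp_of_Omega_empty ν M g K W s hΩ Φ V1 (hdec := hdec),
    genOp_genDataOfRecord_of_Omega_empty V ν M g K W s (fun _ => ∅) 0 (hdec := hdec) hΩ]
  congr 1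
  funext y
  rw [update_baseCfg_one_eq_pairCfg, hΩ', hΛ, Set.compl_empty, Set.inter_empty]
  rfl

end TkOne

/-! ## §2  12a's weights at the empty regions: `χ(∅, ∅) = 1`, the surviving factor `e^{−½ quad_0(∅)}`, the slot at the 𝐓-weights of record -/

section WeightsAtEmpty

variable {F : T4Family} {N : ℕ} [NeZero N] {V : Type} [SeminormedAddCommGroup V]
variable {ν : Stage7Numerics} {A₁ cR : ℝ} {p : B12.RunParams} {g : ℕ → ℝ}

/-- No χ_{k+1}-cube lies in the empty region (cubes are non-empty). [cite: Balaban1988Convergent, (3.2) p.265 (bookkeeping)] -/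
theorem cubesIn_cubeχ_empty (k : ℕ) : cubesIn (cubeχ F ν p g k) (∅ : Set (Site (F.P p.K) 0)) = ∅ := by
  ext c
  simp only [mem_cubesIn, Finset.notMem_empty, iff_false, Set.subset_empty_iff]
  exact (cubeEnl_zero_nonempty (F.P p.K) (sideχ F ν p g k) c.2).ne_empty

omit [NeZero N] in
/-- `χ^{(j)}(∅) = 1` (empty product). [cite: Balaban1988Convergent, (3.16) p.268 (bookkeeping)] -/
theorem chiSmallAW_empty (j : ℕ) (ω : MultiCfg (F.P p.K) (SU N) V) : chiSmallAW F N V ν A₁ p g j ∅ ω = 1 := by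
  classical
  rw [chiSmallAW_eq_ite]
  exact if_pos fun c hc => absurd hc (Finset.notMem_empty c)

omit [NeZero N] in
/-- `χ^{(j)c}(∅) = 1` (empty product). [cite: Balaban1988Convergent, (3.16) p.268 (bookkeeping)] -/
theorem chiLargeAW_empty (j : ℕ) (ω : MultiCfg (F.P p.K) (SU N) V) : chiLargeAW F N V ν A₁ p g j ∅ ω = 1 := by
  classical
  rw [chiLargeAW_eq_ite]
  exact if_pos fun c hc => absurd hc (Finset.notMem_empty c)

omit [SeminormedAddCommGroup V] in
/-- `χ′_j(∅) = 1` (empty product). [cite: Balaban1988Convergent, (3.3) p.265 (bookkeeping)] -/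
theorem chiPrimeW_empty (j : ℕ) (ω : MultiCfg (F.P p.K) (SU N) V) : chiPrimeW F N V ν A₁ p g j ∅ ω = 1 := by
  classical
  rw [chiPrimeW_eq_ite]
  exact if_pos fun c hc => absurd hc (Finset.notMem_empty c)

/-- **`χ(∅, ∅) = 1` OF RECORD**: at a generation with no A-region (`Y = Z_{j+1} ∩ Ω_{j+1} = ∅`, `S_{j+1} = ∅`) every (3.21) factor of 12a's `chiAW` is an
empty product. [cite: Balaban1988Convergent, (3.21) p.269, (2.22) p.258 (bookkeeping)] -/
theorem chiAW_empty_empty (j : ℕ) (ω : MultiCfg (F.P p.K) (SU N) V) : chiAW F N V ν A₁ p g j ∅ ∅ ω = 1 := by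
  unfold chiAW
  rw [if_pos (Set.empty_subset _), sdiff_self, Set.bot_eq_empty, cubesIn_cubeχ_empty, chiSmallAW_empty, chiLargeAW_empty, chiPrimeW_empty]
  norm_num

/-- **THE SURVIVING FACTOR**: at the empty regions 12a's A-weight of record is `e^{−½·quad_j(∅)}` — LOCATED: print has NO factor here ((2.22): no
A-integral), while 11a∕12a's residual `quad` carries no law «vanishes at zero fluctuation field», so at the record the no-expansion generation keeps the
reading `exp(−½·quad_j(∅)(ω))`; it is `1` at any witness whose `quad_j(Λ′)(ω)` is a genuine quadratic form in `(ω j).2` read at `A_j = 0`.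
[cite: Balaban1988Convergent, (2.21)–(2.22) p.258, (3.23) p.270 (located typing corner)] -/
theorem w_tkWeightsOfRecord_empty (Z : TkResidualW F N V p.K) (j : ℕ) (ω : MultiCfg (F.P p.K) (SU N) V) :
    (tkWeightsOfRecord F N V ν A₁ cR p g Z).w j ∅ ∅ ∅ ω = Real.exp (-(1 / 2 : ℝ) * Z.quad j ∅ ω) := by
  unfold TkWeights.w
  rw [tkWeightsOfRecord_chiA, chiAW_empty_empty, one_mul, tkWeightsOfRecord_quad]

/-- The generation-`0` weight `ζ_0(Y)` of record at the two-scale configuration: the residual factor times p. 256's regularity function of `U` on `Y`.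
[cite: Balaban1988Convergent, (2.21) p.258, (2.10) p.256 (bookkeeping)] -/
theorem zeta_tkWeightsOfRecord_apply (Z : TkResidualW F N V p.K) (j : ℕ) (Y : Set (Site (F.P p.K) 0)) (ω : MultiCfg (F.P p.K) (SU N) V) :
    (tkWeightsOfRecord F N V ν A₁ cR p g Z).ζ j Y ω = Z.ζ0 j Y ω * chiRegW F N V ν cR p g j Y ω := rfl

end WeightsAtEmpty

section WeightsAtPairCfg

variable {F : T4Family} {N : ℕ} [NeZero N] {V : Type} [NormedAddCommGroup V]
variable {ν : Stage7Numerics} {A₁ cR : ℝ} {p : B12.RunParams} {g : ℕ → ℝ}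

open Classical in
/-- p. 256's regularity function at scale `0` READS ONLY THE FINE FIELD `U` of the two-scale configuration. [cite: Balaban1988Convergent, (2.10) p.256 (bookkeeping)] -/
theorem chiRegW_zero_pairCfg (Y : Set (Site (F.P p.K) 0)) (V1 : GaugeField (F.P p.K) 1 (SU N)) (U : GaugeField (F.P p.K) 0 (SU N)) :
    chiRegW F N V ν cR p g 0 Y (pairCfg V1 U) =
      if PlaqSmallOn (B8Eq17ClassAkV1.plaqsOf (B15DeterminingSets.pts 0 Y)) (cR * epsOfRecord ν g 0) U then 1 else 0 := by
  simp only [chiRegW, pairCfg_zero]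

omit [NeZero N] in
/-- **UNDER A ONE-SCALE LOCALITY LAW `ζ0_0` DOES NOT SEE `V₁`**: if the residual factor of generation `0` reads only `ω 0` (the ONE-SCALE law, DISPLAYED — v1.1,
T0′ of the FLAG №1 R2b cure: 12b's row `TkResidualW.LocalLaws` is re-typed IN PLACE to print's TWO-SCALE law, [III] (3.1)–(3.4) pp.264–267, under which `ζ0_0` MAY read
`V₁`; the record's uniform `ζ0` and K0a's pins are one-scale), then at the two-scale configuration it is a function of the integrated fine field `U` alone.
[cite: Balaban1988Convergent, (3.2)–(3.3) p.265, p.267] -/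
theorem zeta0_zero_pairCfg_eq_of_localLaws {Z : TkResidualW F N V p.K}
    (hZ : ∀ (Y : Set (Site (F.P p.K) 0)) (ω ω' : MultiCfg (F.P p.K) (SU N) V), ω 0 = ω' 0 → Z.ζ0 0 Y ω = Z.ζ0 0 Y ω') (Y : Set (Site (F.P p.K) 0))
    (V1 V1' : GaugeField (F.P p.K) 1 (SU N)) (U : GaugeField (F.P p.K) 0 (SU N)) :
    Z.ζ0 0 Y (pairCfg V1 U) = Z.ζ0 0 Y (pairCfg V1' U) :=
  hZ Y _ _ (by rw [pairCfg_zero, pairCfg_zero])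

/-- **THE NO-EXPANSION INTEGRAND AT THE 𝐓-WEIGHTS OF RECORD** (12a): `ζ0_0(T)·χreg_0(T)·e^{−½ quad_0(∅)}·Φ`, every factor read at the two-scale
configuration `(U, V₁)`. [cite: Balaban1988Convergent, (2.21)–(2.22) p.258, (2.10) p.256, (3.23) p.270] -/
theorem noExpIntegrand_tkWeightsOfRecord (Z : TkResidualW F N V p.K)
    (Φ : SFluct (F.P p.K) V → B15DeterminingSets.MSField (F.P p.K) (SU N) → ℝ) (V1 : GaugeField (F.P p.K) 1 (SU N))
    (U : GaugeField (F.P p.K) 0 (SU N)) :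
    noExpIntegrand F N V p.K (tkWeightsOfRecord F N V ν A₁ cR p g Z) Φ V1 U =
      Z.ζ0 0 Set.univ (pairCfg V1 U) * chiRegW F N V ν cR p g 0 Set.univ (pairCfg V1 U) *
        (Real.exp (-(1 / 2 : ℝ) * Z.quad 0 ∅ (pairCfg V1 U)) *
          Φ (fun _ => ∅, fun j => (pairCfg (V := V) V1 U j).2) (fun j => (pairCfg (V := V) V1 U j).1)) := by
  unfold noExpIntegrand
  rw [zeta_tkWeightsOfRecord_apply, w_tkWeightsOfRecord_empty]

end WeightsAtPairCfg

/-! ## §3  Measure theory: sufficiency of a fibre identity; the a.e. face of the no-expansion slot as def-T's transport of record -/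

section FibreCongr

variable {P : Params} {j : ℕ} {G : Type*} [GaugeGroup G] [MeasurableSpace G] [HaarData G] [StandardBorelSpace G]

/-- **SUFFICIENCY OF A FIBRE IDENTITY** for the equality of two one-step kernel transports: if two integrand families `f V U`, `g V U` agree ON THE
GRAPH `V = Ū` (for every fine field `U`), their transports agree for `dV`-ALMOST EVERY coarse field `V` — where the marginal density is positive the
averaging kernel lives on the fibre `{Ū = V}` (`avgKernel_fibre_ae` through `withDensity_margDensity`), where it vanishes both transports vanish.  No
integrability needed; the converse is false (equal transports only force equal fibre integrals). [cite: Balaban1988Convergent, (3.1) p.264; Balaban1985Averaging, (10) p.19] -/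
theorem transportK_congr_ae_of_fibre {avg : GaugeField P j G → GaugeField P (j + 1) G} (havg : Measurable avg) (hac : HaarAC avg)
    {f g : GaugeField P (j + 1) G → GaugeField P j G → ℝ} (hfg : ∀ U, f (avg U) U = g (avg U) U) :
    (fun V => transportK avg (f V) V) =ᵐ[fieldMeasure P (j + 1) G] fun V => transportK avg (g V) V := by
  have hfib := avgKernel_fibre_ae (P := P) (G := G) havg
  rw [← withDensity_margDensity (fieldMeasure P j G) (fieldMeasure P (j + 1) G) havg hac,
    ae_withDensity_iff measurable_margDensity.coe_nnreal_ennreal] at hfib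
  filter_upwards [hfib] with V hV
  show kernelTransport _ _ avg (f V) V = kernelTransport _ _ avg (g V) V
  unfold kernelTransport
  by_cases h0 : margDensity (fieldMeasure P j G) (fieldMeasure P (j + 1) G) avg V = 0
  · simp only [h0, NNReal.coe_zero, zero_mul]
  · have h1 : avgKernel avg V {U | avg U = V} = 1 := hV (by exact_mod_cast h0)
    have hS : MeasurableSet {U : GaugeField P j G | avg U = V} := measurableSet_eq_fun havg measurable_const
    have hc : avgKernel avg V {U | avg U = V}ᶜ = 0 := (prob_compl_eq_zero_iff hS).2 h1
    have hae : ∀ᵐ U ∂(avgKernel avg V), avg U = V := mem_ae_iff.2 hc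
    have hint : ∫ U, f V U ∂(avgKernel avg V) = ∫ U, g V U ∂(avgKernel avg V) :=
      integral_congr_ae (hae.mono fun U hU => by rw [← hU]; exact hfg U)
    show (margDensity _ _ avg V : ℝ) * ∫ U, f V U ∂(avgKernel avg V) = (margDensity _ _ avg V : ℝ) * ∫ U, g V U ∂(avgKernel avg V)
    rw [hint]

end FibreCongr

section AEFace

variable {F : T4Family} {N : ℕ} [NeZero N] {V : Type} [NormedAddCommGroup V] [InnerProductSpace ℝ V] [FiniteDimensional ℝ V]
  [MeasurableSpace V] [BorelSpace V]

/-- **THE A.E. FACE OF THE NO-EXPANSION 𝐓-SLOT**: for `0 < K` (the `HaarAC` range of the averaging of record) and a no-expansion integrand family that is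
JOINTLY MEASURABLE AND BOUNDED (displayed provisos, as def-T's `TStepProvisos.measW`∕`absW_le`: the residual readings `ζ0`, `quad`, the background map
of the operand are not measurable by construction), `𝐓_1(s′) Φ` IS def-T's one-step transport of record of the `V₁`-slice `U ↦ ζ_0·w_0·Φ (U, V₁)`, for
`dV₁`-ALMOST EVERY `V₁` (this seat's full-bond-set face `kernelRTOfRecord_full_ae_eq_transportOfRecord`). [cite: Balaban1988Convergent, (2.21)–(2.22) p.258, (3.1) p.264, (3.24)–(3.25) p.270] -/
theorem TkOfRecord_one_ae_eq_transportOfRecord_of_Omega_empty (ν : Stage7Numerics) (M : ℕ) (g : ℕ → ℝ) {K : ℕ} (hK : 0 < K)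
    (W : TkWeights F N V K) (s : SeqOfRecord F ν M g K 1) (hΩ : s.Ω 1 = ∅)
    (Φ : SFluct (F.P K) V → B15DeterminingSets.MSField (F.P K) (SU N) → ℝ) {C : ℝ}
    (hm : Measurable (Function.uncurry (noExpIntegrand F N V K W Φ))) (hC : ∀ V1 U, |noExpIntegrand F N V K W Φ V1 U| ≤ C) :
    TkOfRecord F N V ν M g K W 1 s Φ =ᵐ[fieldMeasure (F.P K) 1 (SU N)]
      fun V1 => transportOfRecord F N K 0 (noExpIntegrand F N V K W Φ V1) V1 := by
  classical
  set D := genDataOfRecord F N V ν M g K W s (fun _ => ∅) 0 with hD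
  have hV : ∀ b, b ∈ D.sV := mem_sV_of_Omega_empty V ν M g K W s (fun _ => ∅) 0 hΩ
  have hV' : ∀ b, b ∈ D.sV' := mem_sV'_of_Omega_empty V ν M g K W s (fun _ => ∅) 0 hΩ
  have hpt : ∀ V1, TkOfRecord F N V ν M g K W 1 s Φ V1 =
      kernelRTOfRecord F N K 0 D.sV D.sV' (fun y => noExpIntegrand F N V K W Φ V1 (Function.updateFinset (fun _ => 1) D.sV y))
        (fun b => V1 b) :=
    fun V1 => TkOfRecord_one_eq_kernelRT_of_Omega_empty ν M g K W s hΩ Φ V1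
  have hmf : Measurable (Function.uncurry fun (V1 : GaugeField (F.P K) 1 (SU N)) (y : ↥D.sV → SU N) =>
      noExpIntegrand F N V K W Φ V1 (Function.updateFinset (fun _ => 1) D.sV y)) :=
    hm.comp (measurable_fst.prodMk (measurable_updateFinset.comp measurable_snd))
  have hface := kernelRTOfRecord_full_ae_eq_transportOfRecord F N K 0 hK (hdec := inferInstance) D.sV hV D.sV' hV'
    (fun V1 y => noExpIntegrand F N V K W Φ V1 (Function.updateFinset (fun _ => 1) D.sV y)) hmf (fun V1 y => hC V1 _)
  filter_upwards [hface] with V1 h1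
  rw [hpt V1, h1]
  simp only [updateFinset_one_restrict_of_forall_mem hV]

end AEFace

/-! ## §4  At the Stage-12 record: the pre-𝐑 slot and the §2-form slot at the all-large-field sequence; (S1ᵀ)_0 there as a transport equation -/

section AtRecord

variable {F : T4Family} {N : ℕ} [NeZero N]

/-- **THE PRE-𝐑 SLOT OF RECORD AT LEVEL 1, UNFOLDED** (def-T's (†) at `k = 0`, `χ₀ ≡ 1`, level `0` of the post-𝐑 family `= ρ₀`): for EVERY new sequence `s′`,
`slotT_1(s′)(V₁) = ∫dU δ(ŪV₁⁻¹) [w(s′)(U, V₁) · ρ₀(U)]` as the transport of record of the step-weighted Wilson start. [cite: Balaban1988Convergent, (3.1) p.264, Thm 1 p.262, (2.18) p.257] -/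
theorem slotsTOfRecord_one_apply (ν : Stage7Numerics) (τ : TowerNumerics) (E : B12.RunParams → ℝ) (w : StepWeightsOfRecord F N ν τ.M)
    (ppSel : PpSelOfRecord F ν τ.M) (p : B12.RunParams) (g : ℕ → ℝ) (s : SeqOfRecord F ν τ.M g p.K 1) (V1 : GaugeField (F.P p.K) 1 (SU N)) :
    slotsTOfRecord F N ν τ E w ppSel p g 1 s V1 =
      transportOfRecord F N p.K 0 (fun U => w p g 0 s U V1 * rhoZeroOfRecord F N p.K (g 0) (E p) U) V1 := by
  rw [slotsTOfRecord_succ, tstepOfRecord_apply]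
  simp only [chiSeqOfRecord_zero, one_mul]
  rfl

variable (θ : Stage12Params F N) (p : B12.RunParams)

/-- The 𝐓-weights of record of the run ARE 12a's weights at the run's letters (`rfl`). [cite: Balaban1988Convergent, (2.21) p.258 (bookkeeping)] -/
theorem WtOfRecord₁₂_eq : WtOfRecord₁₂ F N θ p =
    tkWeightsOfRecord F N (FluctV N) θ.ν θ.A₁ θ.s2.cR p (gOfRecord₁₀ F N θ.toStage9Params p) (θ.Zt p.K) := rfl

/-- **THE NO-EXPANSION INTEGRAND AT THE RECORD, EXPLICIT**: at the 𝐓-weights of record and the §2 operand `exp A_1(s′)` it reads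
`ζ0_0(T)·χreg_0(T)·e^{−½ quad_0(∅)}·exp A_1(s′)(U_1(𝐖))` at the two-scale configuration `𝐖 = (U, V₁)` (fluctuation fields `0`).
[cite: Balaban1988Convergent, (2.18) p.257, (2.21)–(2.23) p.258, (2.10) p.256] -/
theorem noExpIntegrand_WtOfRecord₁₂_sect2Operand (s : SeqOfRecord F θ.ν θ.τ9.M (gOfRecord₁₀ F N θ.toStage9Params p) p.K 1)
    (t : Sect2.TermValues (F.P p.K) (MatA N) (FluctV N) θ.τ9.M) (Ek : ℝ) (U : BgMap F N p.K) (V1 : GaugeField (F.P p.K) 1 (SU N))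
    (Uf : GaugeField (F.P p.K) 0 (SU N)) :
    noExpIntegrand F N (FluctV N) p.K (WtOfRecord₁₂ F N θ p)
        (sect2Operand F N (FluctV N) p.K (settingOfRecord₁₂ F N θ p) (θ.Rz p.K) s t Ek U) V1 Uf =
      (θ.Zt p.K).ζ0 0 Set.univ (pairCfg V1 Uf) *
          chiRegW F N (FluctV N) θ.ν θ.s2.cR p (gOfRecord₁₀ F N θ.toStage9Params p) 0 Set.univ (pairCfg V1 Uf) *
        (Real.exp (-(1 / 2 : ℝ) * (θ.Zt p.K).quad 0 ∅ (pairCfg V1 Uf)) *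
          Real.exp ((sect2ActionDataOfRecord F N (FluctV N) p.K (settingOfRecord₁₂ F N θ p) (θ.Rz p.K) s t
            (fun _ => ∅, fun j => (pairCfg (V := FluctV N) V1 Uf j).2) Ek).action23 1 (U fun j => (pairCfg (V := FluctV N) V1 Uf j).1))) :=
  noExpIntegrand_tkWeightsOfRecord (θ.Zt p.K) _ V1 Uf

/-- **THE §2-FORM SLOT `𝐓_1(s′) exp A_1(s′)` OF RECORD AT THE ALL-LARGE-FIELD SEQUENCE, UNFOLDED POINTWISE**: one restricted kernel transport of record on the
full bond sets of the explicit no-expansion integrand. [cite: Balaban1988Convergent, (2.18) p.257, (2.21)–(2.23) p.258, (3.24) p.270] -/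
theorem sect2Slot_one_eq_kernelRT_of_Omega_empty (s : SeqOfRecord F θ.ν θ.τ9.M (gOfRecord₁₀ F N θ.toStage9Params p) p.K 1) (hΩ : s.Ω 1 = ∅)
    (t : Sect2.TermValues (F.P p.K) (MatA N) (FluctV N) θ.τ9.M) (Ek : ℝ) (U : BgMap F N p.K) (V1 : GaugeField (F.P p.K) 1 (SU N))
    {hdec : DecidableEq (PBond (F.P p.K) 0)} :
    sect2Slot F N (FluctV N) p.K (settingOfRecord₁₂ F N θ p) (θ.Rz p.K) (WtOfRecord₁₂ F N θ p) s t Ek U V1 =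
      kernelRTOfRecord F N p.K 0 (genDataOfRecord F N (FluctV N) θ.ν θ.τ9.M _ p.K (WtOfRecord₁₂ F N θ p) s (fun _ => ∅) 0).sV
        (genDataOfRecord F N (FluctV N) θ.ν θ.τ9.M _ p.K (WtOfRecord₁₂ F N θ p) s (fun _ => ∅) 0).sV'
        (fun y => noExpIntegrand F N (FluctV N) p.K (WtOfRecord₁₂ F N θ p)
          (sect2Operand F N (FluctV N) p.K (settingOfRecord₁₂ F N θ p) (θ.Rz p.K) s t Ek U) V1
          (Function.updateFinset (fun _ => 1) (genDataOfRecord F N (FluctV N) θ.ν θ.τ9.M _ p.K (WtOfRecord₁₂ F N θ p) s (fun _ => ∅) 0).sV y))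
        (fun b => V1 b) :=
  TkOfRecord_one_eq_kernelRT_of_Omega_empty θ.ν θ.τ9.M _ p.K (WtOfRecord₁₂ F N θ p) s hΩ _ V1

/-- **… AND ALMOST EVERYWHERE AS def-T's TRANSPORT OF RECORD** (`0 < K`; the integrand family jointly measurable and bounded — displayed).
[cite: Balaban1988Convergent, (2.18) p.257, (3.1) p.264, (3.25) p.270] -/
theorem sect2Slot_one_ae_eq_transport_of_Omega_empty (hK : 0 < p.K)
    (s : SeqOfRecord F θ.ν θ.τ9.M (gOfRecord₁₀ F N θ.toStage9Params p) p.K 1) (hΩ : s.Ω 1 = ∅)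
    (t : Sect2.TermValues (F.P p.K) (MatA N) (FluctV N) θ.τ9.M) (Ek : ℝ) (U : BgMap F N p.K) {C : ℝ}
    (hm : Measurable (Function.uncurry (noExpIntegrand F N (FluctV N) p.K (WtOfRecord₁₂ F N θ p)
      (sect2Operand F N (FluctV N) p.K (settingOfRecord₁₂ F N θ p) (θ.Rz p.K) s t Ek U))))
    (hC : ∀ V1 Uf, |noExpIntegrand F N (FluctV N) p.K (WtOfRecord₁₂ F N θ p)
      (sect2Operand F N (FluctV N) p.K (settingOfRecord₁₂ F N θ p) (θ.Rz p.K) s t Ek U) V1 Uf| ≤ C) :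
    sect2Slot F N (FluctV N) p.K (settingOfRecord₁₂ F N θ p) (θ.Rz p.K) (WtOfRecord₁₂ F N θ p) s t Ek U =ᵐ[fieldMeasure (F.P p.K) 1 (SU N)]
      fun V1 => transportOfRecord F N p.K 0 (noExpIntegrand F N (FluctV N) p.K (WtOfRecord₁₂ F N θ p)
        (sect2Operand F N (FluctV N) p.K (settingOfRecord₁₂ F N θ p) (θ.Rz p.K) s t Ek U) V1) V1 :=
  TkOfRecord_one_ae_eq_transportOfRecord_of_Omega_empty θ.ν θ.τ9.M _ hK (WtOfRecord₁₂ F N θ p) s hΩ _ hm hC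

/-- **THE (S1ᵀ)_0 CLAUSE AT THE ALL-LARGE-FIELD SEQUENCE**: if `TLaw₁₂ θ p 0` holds, its witness `(t, E_1)` (universal 𝐄-terms, `LawsT … 0` on every new
sequence) satisfies at `s′` with `Ω₁(s′) = ∅` the GUARD-FREE dichotomy «`slotT_1(s′)` is the zero function, or `slotT_1(s′)(V₁) = 𝐓_1(s′) exp A_1(s′) (V₁)` for
`dV₁`-a.e. `V₁`» — the front factor `χ_1(s′) ≡ 1` there, so the (3.25) identity is demanded almost everywhere. [cite: Balaban1988Convergent, (3.25) p.270, remark p.262, Theorem p.245] -/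
theorem tLaw₁₂_zero_clause_of_Omega_empty (hT : TLaw₁₂ F N θ p 0)
    (s : SeqOfRecord F θ.ν θ.τ9.M (gOfRecord₁₀ F N θ.toStage9Params p) p.K 1) (hΩ : s.Ω 1 = ∅) :
    ∃ (t : SeqOfRecord F θ.ν θ.τ9.M (gOfRecord₁₀ F N θ.toStage9Params p) p.K 1 → Sect2.TermValues (F.P p.K) (MatA N) (FluctV N) θ.τ9.M)
      (Ek : SeqOfRecord F θ.ν θ.τ9.M (gOfRecord₁₀ F N θ.toStage9Params p) p.K 1 → ℝ),
      Sect2.UniversalE t ∧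
      (∀ s', Sect2.LawsT (sect2TowerOfRecord F N (FluctV N) p.K (settingOfRecord₁₂ F N θ p) (θ.Rz p.K) s' (t s'))
        (settingOfRecord₁₂ F N θ p).lf (settingOfRecord₁₂ F N θ p).βc 0) ∧
      (slotsTOfRecord F N θ.ν θ.τ9 (EOfRecord₁₀ F N θ.toStage9Params) (wOfRecord₉ F N θ.toStage9Params) θ.ppSel p
          (gOfRecord₁₀ F N θ.toStage9Params p) 1 s = 0 ∨
        ∀ᵐ V1 ∂fieldMeasure (F.P p.K) 1 (SU N),
          slotsTOfRecord F N θ.ν θ.τ9 (EOfRecord₁₀ F N θ.toStage9Params) (wOfRecord₉ F N θ.toStage9Params) θ.ppSel p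
              (gOfRecord₁₀ F N θ.toStage9Params p) 1 s V1 =
            sect2Slot F N (FluctV N) p.K (settingOfRecord₁₂ F N θ p) (θ.Rz p.K) (WtOfRecord₁₂ F N θ p) s (t s) (Ek s)
              (UbgOfRecord₁₂ F N θ p 1 s) V1) := by
  obtain ⟨t, Ek, hu, hs⟩ := (tLaw₁₂_iff F N θ p 0).mp hT
  refine ⟨t, Ek, hu, fun s' => (hs s').1, ?_⟩
  rcases (hs s).2 with h0 | hid
  · exact Or.inl h0
  · refine Or.inr ?_
    filter_upwards [hid] with V1 hV1
    exact hV1 (by rw [chiSeqOfRecord_eq_one_of_Omega_empty F N θ.ν θ.τ9.M _ p.K 1 s hΩ V1]; exact one_ne_zero)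

/-- **THE NO-EXPANSION COHERENCE EQUATION, IN KERNEL** (dag-n11-d g2's READING, pub-ymgap INBOX l.14524): at `s′` with `Ω₁(s′) = ∅`, for a witness pair
`(t, E_1)` of the (S1ᵀ)_0 dichotomy there and under the displayed measurability∕boundedness of the no-expansion integrand (`0 < K`), EITHER the pre-𝐑 slot
`slotT_1(s′)` is the zero function OR the two ONE-STEP TRANSPORTS OF RECORD agree `dV₁`-a.e.:
`∫dU δ(ŪV₁⁻¹) w(s′)(U,V₁)·ρ₀(U) = ∫dU δ(ŪV₁⁻¹) ζ0_0(T)·χreg_0(T)·e^{−½quad_0(∅)}·exp A_1(s′)(U_1) (U, V₁)` — def-T's step weights of record against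
12a's 𝐓-weights of record and the §2 operand, ZERO new terms. [cite: Balaban1988Convergent, Theorem p.245, (3.1) p.264, (3.25) p.270, (2.21)–(2.23) p.258] -/
theorem tLaw₁₂_zero_coherence_of_Omega_empty (hK : 0 < p.K)
    (s : SeqOfRecord F θ.ν θ.τ9.M (gOfRecord₁₀ F N θ.toStage9Params p) p.K 1) (hΩ : s.Ω 1 = ∅)
    (t : Sect2.TermValues (F.P p.K) (MatA N) (FluctV N) θ.τ9.M) (Ek : ℝ)
    (hcl : slotsTOfRecord F N θ.ν θ.τ9 (EOfRecord₁₀ F N θ.toStage9Params) (wOfRecord₉ F N θ.toStage9Params) θ.ppSel p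
          (gOfRecord₁₀ F N θ.toStage9Params p) 1 s = 0 ∨
        ∀ᵐ V1 ∂fieldMeasure (F.P p.K) 1 (SU N),
          slotsTOfRecord F N θ.ν θ.τ9 (EOfRecord₁₀ F N θ.toStage9Params) (wOfRecord₉ F N θ.toStage9Params) θ.ppSel p
              (gOfRecord₁₀ F N θ.toStage9Params p) 1 s V1 =
            sect2Slot F N (FluctV N) p.K (settingOfRecord₁₂ F N θ p) (θ.Rz p.K) (WtOfRecord₁₂ F N θ p) s t Ek
              (UbgOfRecord₁₂ F N θ p 1 s) V1)
    {C : ℝ}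
    (hm : Measurable (Function.uncurry (noExpIntegrand F N (FluctV N) p.K (WtOfRecord₁₂ F N θ p)
      (sect2Operand F N (FluctV N) p.K (settingOfRecord₁₂ F N θ p) (θ.Rz p.K) s t Ek (UbgOfRecord₁₂ F N θ p 1 s)))))
    (hC : ∀ V1 Uf, |noExpIntegrand F N (FluctV N) p.K (WtOfRecord₁₂ F N θ p)
      (sect2Operand F N (FluctV N) p.K (settingOfRecord₁₂ F N θ p) (θ.Rz p.K) s t Ek (UbgOfRecord₁₂ F N θ p 1 s)) V1 Uf| ≤ C) :
    slotsTOfRecord F N θ.ν θ.τ9 (EOfRecord₁₀ F N θ.toStage9Params) (wOfRecord₉ F N θ.toStage9Params) θ.ppSel p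
        (gOfRecord₁₀ F N θ.toStage9Params p) 1 s = 0 ∨
      (fun V1 => transportOfRecord F N p.K 0 (fun U => wOfRecord₉ F N θ.toStage9Params p (gOfRecord₁₀ F N θ.toStage9Params p) 0 s U V1 *
          rhoZeroOfRecord F N p.K (gOfRecord₁₀ F N θ.toStage9Params p 0) (EOfRecord₁₀ F N θ.toStage9Params p) U) V1)
        =ᵐ[fieldMeasure (F.P p.K) 1 (SU N)]
      fun V1 => transportOfRecord F N p.K 0 (noExpIntegrand F N (FluctV N) p.K (WtOfRecord₁₂ F N θ p)
        (sect2Operand F N (FluctV N) p.K (settingOfRecord₁₂ F N θ p) (θ.Rz p.K) s t Ek (UbgOfRecord₁₂ F N θ p 1 s)) V1) V1 := by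
  rcases hcl with h0 | hid
  · exact Or.inl h0
  · refine Or.inr ?_
    filter_upwards [hid, sect2Slot_one_ae_eq_transport_of_Omega_empty θ p hK s hΩ t Ek (UbgOfRecord₁₂ F N θ p 1 s) hm hC] with V1 h1 h2
    rw [← slotsTOfRecord_one_apply, h1, h2]

/-- **SUFFICIENCY: A FIBRE IDENTITY OF INTEGRANDS DISCHARGES THE IDENTITY BRANCH AT `s′`** (what a K1′ witness's `Zt` must meet at its first
no-expansion step): if for EVERY fine field `U` the step-weighted Wilson start `w(s′)(U, Ū)·ρ₀(U)` EQUALS the no-expansion integrand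
`ζ0_0(T)·χreg_0(T)·e^{−½quad_0(∅)}·exp A_1(s′)(U_1) (U, Ū)` ON THE GRAPH `V₁ = Ū`, then (under the displayed measurability∕boundedness, `0 < K`) the
(3.25) identity `slotT_1(s′)(V₁) = 𝐓_1(s′) exp A_1(s′)(V₁)` holds for `dV₁`-a.e. `V₁` — the identity clause of 12b's `HasSect2FormAtZ` at `s′`, for this
term-value witness, constant and background map. [cite: Balaban1988Convergent, (3.25) p.270, Theorem p.245, (3.1) p.264, (2.18) p.257] -/
theorem slotsT_one_ae_eq_sect2Slot_of_fibre_identity (hK : 0 < p.K)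
    (s : SeqOfRecord F θ.ν θ.τ9.M (gOfRecord₁₀ F N θ.toStage9Params p) p.K 1) (hΩ : s.Ω 1 = ∅)
    (t : Sect2.TermValues (F.P p.K) (MatA N) (FluctV N) θ.τ9.M) (Ek : ℝ) (U : BgMap F N p.K) {C : ℝ}
    (hm : Measurable (Function.uncurry (noExpIntegrand F N (FluctV N) p.K (WtOfRecord₁₂ F N θ p)
      (sect2Operand F N (FluctV N) p.K (settingOfRecord₁₂ F N θ p) (θ.Rz p.K) s t Ek U))))
    (hC : ∀ V1 Uf, |noExpIntegrand F N (FluctV N) p.K (WtOfRecord₁₂ F N θ p)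
      (sect2Operand F N (FluctV N) p.K (settingOfRecord₁₂ F N θ p) (θ.Rz p.K) s t Ek U) V1 Uf| ≤ C)
    (hfib : ∀ Uf : GaugeField (F.P p.K) 0 (SU N),
      wOfRecord₉ F N θ.toStage9Params p (gOfRecord₁₀ F N θ.toStage9Params p) 0 s Uf ((avOfRecord F N p.K 0).avg Uf) *
          rhoZeroOfRecord F N p.K (gOfRecord₁₀ F N θ.toStage9Params p 0) (EOfRecord₁₀ F N θ.toStage9Params p) Uf =
        noExpIntegrand F N (FluctV N) p.K (WtOfRecord₁₂ F N θ p)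
          (sect2Operand F N (FluctV N) p.K (settingOfRecord₁₂ F N θ p) (θ.Rz p.K) s t Ek U) ((avOfRecord F N p.K 0).avg Uf) Uf) :
    ∀ᵐ V1 ∂fieldMeasure (F.P p.K) 1 (SU N),
      chiSeqOfRecord F N θ.ν θ.τ9.M (gOfRecord₁₀ F N θ.toStage9Params p) p.K 1 s V1 ≠ 0 →
        slotsTOfRecord F N θ.ν θ.τ9 (EOfRecord₁₀ F N θ.toStage9Params) (wOfRecord₉ F N θ.toStage9Params) θ.ppSel p
            (gOfRecord₁₀ F N θ.toStage9Params p) 1 s V1 =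
          sect2Slot F N (FluctV N) p.K (settingOfRecord₁₂ F N θ p) (θ.Rz p.K) (WtOfRecord₁₂ F N θ p) s t Ek U V1 := by
  have h1 := transportK_congr_ae_of_fibre (avOfRecord_measurable F N p.K 0) (avOfRecord_haarAC F N p.K 0 hK)
    (f := fun V1 Uf => wOfRecord₉ F N θ.toStage9Params p (gOfRecord₁₀ F N θ.toStage9Params p) 0 s Uf V1 *
      rhoZeroOfRecord F N p.K (gOfRecord₁₀ F N θ.toStage9Params p 0) (EOfRecord₁₀ F N θ.toStage9Params p) Uf)
    (g := noExpIntegrand F N (FluctV N) p.K (WtOfRecord₁₂ F N θ p)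
      (sect2Operand F N (FluctV N) p.K (settingOfRecord₁₂ F N θ p) (θ.Rz p.K) s t Ek U)) hfib
  have h2 := sect2Slot_one_ae_eq_transport_of_Omega_empty θ p hK s hΩ t Ek U hm hC
  filter_upwards [h1, h2] with V1 e1 e2 _
  rw [slotsTOfRecord_one_apply, e2]
  exact e1

/-- **… HENCE THE WHOLE (S1ᵀ)_0 DICHOTOMY CLAUSE OF 12b AT `s′`** (`HasSect2FormAtZ`'s third conjunct, identity branch), from the fibre identity.
[cite: Balaban1988Convergent, (3.25) p.270, (2.17)–(2.18) p.257] -/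
theorem hasSect2FormAtZ_clause_one_of_fibre_identity (hK : 0 < p.K)
    (s : SeqOfRecord F θ.ν θ.τ9.M (gOfRecord₁₀ F N θ.toStage9Params p) p.K 1) (hΩ : s.Ω 1 = ∅)
    (t : Sect2.TermValues (F.P p.K) (MatA N) (FluctV N) θ.τ9.M) (Ek : ℝ) (U : BgMap F N p.K) {C : ℝ}
    (hm : Measurable (Function.uncurry (noExpIntegrand F N (FluctV N) p.K (WtOfRecord₁₂ F N θ p)
      (sect2Operand F N (FluctV N) p.K (settingOfRecord₁₂ F N θ p) (θ.Rz p.K) s t Ek U))))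
    (hC : ∀ V1 Uf, |noExpIntegrand F N (FluctV N) p.K (WtOfRecord₁₂ F N θ p)
      (sect2Operand F N (FluctV N) p.K (settingOfRecord₁₂ F N θ p) (θ.Rz p.K) s t Ek U) V1 Uf| ≤ C)
    (hfib : ∀ Uf : GaugeField (F.P p.K) 0 (SU N),
      wOfRecord₉ F N θ.toStage9Params p (gOfRecord₁₀ F N θ.toStage9Params p) 0 s Uf ((avOfRecord F N p.K 0).avg Uf) *
          rhoZeroOfRecord F N p.K (gOfRecord₁₀ F N θ.toStage9Params p 0) (EOfRecord₁₀ F N θ.toStage9Params p) Uf =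
        noExpIntegrand F N (FluctV N) p.K (WtOfRecord₁₂ F N θ p)
          (sect2Operand F N (FluctV N) p.K (settingOfRecord₁₂ F N θ p) (θ.Rz p.K) s t Ek U) ((avOfRecord F N p.K 0).avg Uf) Uf) :
    slotsTOfRecord F N θ.ν θ.τ9 (EOfRecord₁₀ F N θ.toStage9Params) (wOfRecord₉ F N θ.toStage9Params) θ.ppSel p
          (gOfRecord₁₀ F N θ.toStage9Params p) 1 s = 0 ∨
      ∀ᵐ V1 ∂fieldMeasure (F.P p.K) 1 (SU N),
        chiSeqOfRecord F N θ.ν θ.τ9.M (gOfRecord₁₀ F N θ.toStage9Params p) p.K 1 s V1 ≠ 0 →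
          slotsTOfRecord F N θ.ν θ.τ9 (EOfRecord₁₀ F N θ.toStage9Params) (wOfRecord₉ F N θ.toStage9Params) θ.ppSel p
              (gOfRecord₁₀ F N θ.toStage9Params p) 1 s V1 =
            sect2Slot F N (FluctV N) p.K (settingOfRecord₁₂ F N θ p) (θ.Rz p.K) (WtOfRecord₁₂ F N θ p) s t Ek U V1 :=
  Or.inr (slotsT_one_ae_eq_sect2Slot_of_fibre_identity θ p hK s hΩ t Ek U hm hC hfib)

end AtRecord

/-! ## §5  The background of record at the all-large-field sequence IS the fine field (on print's class): def-R's (2.12) multi-scale background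
at `Ω₁ = ∅` (`Γ₀ = T`, no other member of the determining set), and the §2 operand read there -/

section BackgroundAtAllLarge

open B15DeterminingSets

variable {P : Params} {G : Type*} [GaugeGroup G]

/-- **AT `Ω₁ = ∅` THE DETERMINING SET OF A LENGTH-1 SEQUENCE IS `Γ₀ = T` ALONE** ((2.2): `Γ₀ = Ω₁ᶜ = T`, `Γ₁ = Ω₁ = ∅`): agreement of the averages
`M_𝐁(U)` with `𝐖` on it ((2.10)–(2.11)) is the equality `U = 𝐖 0` of the scale-`0` fields (`M⁰ = id`). [cite: Balaban1988Convergent, (2.2) p.255, (2.10)–(2.11) p.256] -/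
theorem agreeOn_genSet_one_iff_of_Omega_empty (av : ∀ j, Averaging P j G) (Ω : ℕ → Set (Site P 0)) (hΩ : Ω 1 = ∅) (U : GaugeField P 0 G)
    (W : MSField P G) : AgreeOn (genSet Ω 1) (avgFamily av U) W ↔ U = W 0 := by
  have hΓ0 : gammaRegion Ω 1 0 = Set.univ := by simp [gammaRegion, hΩ]
  have hΓ : ∀ j, j ≠ 0 → gammaRegion Ω 1 j = ∅ := fun j hj => by
    unfold gammaRegion
    split_ifs <;> first | rfl | exact hΩ | omega
  constructor
  · intro h
    funext b
    exact h 0 b (by rw [genSet, hΓ0]; exact Or.inl (Set.mem_univ _))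
  · intro h j b hb
    by_cases hj : j = 0
    · subst hj
      exact congrFun h b
    · rw [genSet, hΓ j hj] at hb
      rcases hb with hb | hb <;> exact absurd hb (Set.notMem_empty _)

/-- **… SO A MINIMISER OF (2.12) THERE IS THE SCALE-`0` DATUM ITSELF**, and it exists iff that datum lies in the regularity class: the constraint set is the
singleton `{𝐖 0}`. [cite: Balaban1988Convergent, (2.12) p.256; Balaban1985Variational, (6) p.278] -/
theorem isMinimizer_genSet_one_iff_of_Omega_empty (av : ∀ j, Averaging P j G) (reg : Set (GaugeField P 0 G)) (Ω : ℕ → Set (Site P 0))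
    (hΩ : Ω 1 = ∅) (W : MSField P G) (U₀ : GaugeField P 0 G) : IsMinimizer av reg (genSet Ω 1) W U₀ ↔ U₀ = W 0 ∧ W 0 ∈ reg := by
  unfold IsMinimizer
  rw [agreeOn_genSet_one_iff_of_Omega_empty av Ω hΩ]
  constructor
  · rintro ⟨hreg, rfl, -⟩
    exact ⟨rfl, hreg⟩
  · rintro ⟨rfl, hreg⟩
    refine ⟨hreg, rfl, fun U _ hUW => ?_⟩
    rw [(agreeOn_genSet_one_iff_of_Omega_empty av Ω hΩ U W).1 hUW]

variable {F : T4Family} {N : ℕ} [NeZero N]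

/-- **PRINT'S CLASS `U_1({Ω_j}, ε₀)` AT `Ω₁ = ∅` IS GLOBAL `ε₀`-REGULARITY** ([6] (1.7): the scale-`0` clause reads every plaquette, the scale-`1` clause reads
the plaquettes meeting `Ω₁ = ∅` — none). [cite: Balaban1985RegularSpaces, (1.7) p.77; Balaban1988Convergent, (2.12) p.256] -/
theorem mem_regMSOfRecord_one_iff_of_Omega_empty (ν : Stage7Numerics) (K : ℕ) (Ω : ℕ → Set (Site (F.P K) 0)) (hΩ : Ω 1 = ∅)
    (U : GaugeField (F.P K) 0 (SU N)) : U ∈ regMSOfRecord F N ν K 1 Ω ↔ PlaqSmall (ν.εreg * (F.P K).eta 0 ^ 2) U := by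
  rw [mem_regMSOfRecord_iff]
  constructor
  · intro h
    exact (B12RegularClassInvariance263.plaqSmallOn_univ_iff _ U).1 (by simpa only [omegaPlaqs_zero] using h 0 (Nat.zero_le 1))
  · intro h j hj
    rcases Nat.le_one_iff_eq_zero_or_eq_one.mp hj with rfl | rfl
    · rw [omegaPlaqs_zero, B12RegularClassInvariance263.plaqSmallOn_univ_iff]
      exact h
    · rw [omegaPlaqs_of_ne_zero Ω one_ne_zero, hΩ]
      intro q hq
      rcases hq with hq | hq | hq | hq <;> exact absurd hq (Set.notMem_empty _)

/-- **def-R's MULTI-SCALE BACKGROUND OF RECORD AT THE ALL-LARGE-FIELD SEQUENCE IS THE FINE FIELD**: at `Ω₁(s′) = ∅`, for a retained configuration `𝐖`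
whose scale-`0` field is `ε₀`-regular, `U_1(s′)(𝐖) = 𝐖 0` — print's `U₁ = V₀` on `Γ₀ = T` ([III] Thm 1's base one level up: no small-field region, no
minimisation left; the chosen minimiser is forced by the constraint). [cite: Balaban1988Convergent, (2.12)–(2.13) pp.256–257, Thm 1 p.262; Balaban1985Variational, Thm 1 (8) p.279] -/
theorem UbgMSOfRecord_one_of_Omega_empty (ν : Stage7Numerics) (M : ℕ) (g : ℕ → ℝ) (K : ℕ) (s : SeqOfRecord F ν M g K 1) (hΩ : s.Ω 1 = ∅)
    (W : MSField (F.P K) (SU N)) (hW : PlaqSmall (ν.εreg * (F.P K).eta 0 ^ 2) (W 0)) : UbgMSOfRecord F N ν M g K 1 s W = W 0 := by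
  have hmem : W 0 ∈ regMSOfRecord F N ν K 1 s.Ω := (mem_regMSOfRecord_one_iff_of_Omega_empty ν K s.Ω hΩ _).2 hW
  have hex : ∃ U₀, IsMinimizer (avOfRecord F N K) (regMSOfRecord F N ν K 1 s.Ω) (genSet s.Ω 1) W U₀ :=
    ⟨W 0, (isMinimizer_genSet_one_iff_of_Omega_empty _ _ s.Ω hΩ W (W 0)).2 ⟨rfl, hmem⟩⟩
  rw [UbgMSOfRecord_apply]
  exact ((isMinimizer_genSet_one_iff_of_Omega_empty _ _ s.Ω hΩ W _).1
    (isMinimizer_UminOfRecord (avOfRecord F N K) (regMSOfRecord F N ν K 1 s.Ω) hex)).1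

/-- … and off the class it is the junk unit configuration (the solvable set is empty there: FILE 1's totalisation).
[cite: Balaban1988Convergent, (2.12) p.256 (typing convention)] -/
theorem UbgMSOfRecord_one_of_Omega_empty_of_not (ν : Stage7Numerics) (M : ℕ) (g : ℕ → ℝ) (K : ℕ) (s : SeqOfRecord F ν M g K 1)
    (hΩ : s.Ω 1 = ∅) (W : MSField (F.P K) (SU N)) (hW : ¬ PlaqSmall (ν.εreg * (F.P K).eta 0 ^ 2) (W 0)) :
    UbgMSOfRecord F N ν M g K 1 s W = fun _ => 1 := by
  rw [UbgMSOfRecord_apply]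
  refine UminOfRecord_of_not _ _ ?_
  rintro ⟨U₀, hU₀⟩
  exact hW ((mem_regMSOfRecord_one_iff_of_Omega_empty ν K s.Ω hΩ _).1
    ((isMinimizer_genSet_one_iff_of_Omega_empty _ _ s.Ω hΩ W U₀).1 hU₀).2)

variable (θ : Stage12Params F N) (p : B12.RunParams)

/-- **12b's BACKGROUND MAP OF RECORD AT LEVEL 1, ALL-LARGE-FIELD SEQUENCE**: `U_1(s′)(𝐖) = 𝐖 0` for `ε₀`-regular `𝐖 0`. [cite: Balaban1988Convergent, (2.12) p.256, Thm 1 p.262] -/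
theorem UbgOfRecord₁₂_one_of_Omega_empty (s : SeqOfRecord F θ.ν θ.τ9.M (gOfRecord₁₀ F N θ.toStage9Params p) p.K 1) (hΩ : s.Ω 1 = ∅)
    (W : MSField (F.P p.K) (SU N)) (hW : PlaqSmall (θ.ν.εreg * (F.P p.K).eta 0 ^ 2) (W 0)) : UbgOfRecord₁₂ F N θ p 1 s W = W 0 :=
  UbgMSOfRecord_one_of_Omega_empty θ.ν θ.τ9.M _ p.K s hΩ W hW

/-- … and `= 1` (junk) for an irregular `𝐖 0`. [cite: Balaban1988Convergent, (2.12) p.256 (typing convention)] -/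
theorem UbgOfRecord₁₂_one_of_Omega_empty_of_not (s : SeqOfRecord F θ.ν θ.τ9.M (gOfRecord₁₀ F N θ.toStage9Params p) p.K 1) (hΩ : s.Ω 1 = ∅)
    (W : MSField (F.P p.K) (SU N)) (hW : ¬ PlaqSmall (θ.ν.εreg * (F.P p.K).eta 0 ^ 2) (W 0)) : UbgOfRecord₁₂ F N θ p 1 s W = fun _ => 1 :=
  UbgMSOfRecord_one_of_Omega_empty_of_not θ.ν θ.τ9.M _ p.K s hΩ W hW

/-- At the two-scale configuration `(U, V₁)` the background of record at level 1 is the integrated fine field `U` itself (for `ε₀`-regular `U`).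
[cite: Balaban1988Convergent, (2.12) p.256, Thm 1 p.262] -/
theorem UbgOfRecord₁₂_one_pairCfg_of_Omega_empty (s : SeqOfRecord F θ.ν θ.τ9.M (gOfRecord₁₀ F N θ.toStage9Params p) p.K 1) (hΩ : s.Ω 1 = ∅)
    (V1 : GaugeField (F.P p.K) 1 (SU N)) (Uf : GaugeField (F.P p.K) 0 (SU N)) (hU : PlaqSmall (θ.ν.εreg * (F.P p.K).eta 0 ^ 2) Uf) :
    UbgOfRecord₁₂ F N θ p 1 s (fun j => (pairCfg (V := FluctV N) V1 Uf j).1) = Uf :=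
  UbgOfRecord₁₂_one_of_Omega_empty θ p s hΩ _ (by rw [pairCfg_zero]; exact hU)

/-- **THE p. 256 REGULARITY FACTOR PUTS THE FINE FIELD IN PRINT'S CLASS** whenever the letters satisfy `cR·ε₀ ≤ δ`: a non-zero `χreg_0(T)` at the
two-scale configuration gives `δ`-regularity of `U` on every plaquette (the located numerics junction between def-R's letter `cR` of (2.10) and the class radius
of (2.12); print: `|∂V₀ − 1| < O(L²)ε₀` on `Γ₀ = T`). [cite: Balaban1988Convergent, (2.10) p.256, (2.12) p.256] -/
theorem plaqSmall_of_chiRegW_zero_univ_ne_zero {ν : Stage7Numerics} {cR : ℝ} {p : B12.RunParams} {g : ℕ → ℝ} {δ : ℝ}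
    (hδ : cR * epsOfRecord ν g 0 ≤ δ) {V1 : GaugeField (F.P p.K) 1 (SU N)} {Uf : GaugeField (F.P p.K) 0 (SU N)}
    (h : chiRegW F N (FluctV N) ν cR p g 0 Set.univ (pairCfg (V := FluctV N) V1 Uf) ≠ 0) : PlaqSmall δ Uf := by
  have h1 := (chiRegW_ne_zero_iff (V := FluctV N) Set.univ _).1 h
  rw [pairCfg_zero] at h1
  intro q
  refine lt_of_lt_of_le (h1 q ?_) hδ
  have hq : q ∈ B8Eq17ClassAkV1.plaqsOf (Set.univ : Set (Site (F.P p.K) 0)) := by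
    rw [B8Eq17ClassAkV1.plaqsOf_univ]; exact Set.mem_univ q
  simpa only [pts, Set.preimage_univ] using hq

/-- **THE NO-EXPANSION INTEGRAND AT THE RECORD WITH THE BACKGROUND RESOLVED**: for an `ε₀`-regular fine field `U` the §2 operand at the background of
record reads `exp A_1(s′)(U)` — the action at the integrated field itself, as print's `U₁ = V₀`. [cite: Balaban1988Convergent, (2.18) p.257, (2.23) p.258, (2.12) p.256, Thm 1 p.262] -/
theorem noExpIntegrand_WtOfRecord₁₂_sect2Operand_of_regular (s : SeqOfRecord F θ.ν θ.τ9.M (gOfRecord₁₀ F N θ.toStage9Params p) p.K 1)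
    (hΩ : s.Ω 1 = ∅) (t : Sect2.TermValues (F.P p.K) (MatA N) (FluctV N) θ.τ9.M) (Ek : ℝ) (V1 : GaugeField (F.P p.K) 1 (SU N))
    (Uf : GaugeField (F.P p.K) 0 (SU N)) (hU : PlaqSmall (θ.ν.εreg * (F.P p.K).eta 0 ^ 2) Uf) :
    noExpIntegrand F N (FluctV N) p.K (WtOfRecord₁₂ F N θ p)
        (sect2Operand F N (FluctV N) p.K (settingOfRecord₁₂ F N θ p) (θ.Rz p.K) s t Ek (UbgOfRecord₁₂ F N θ p 1 s)) V1 Uf =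
      (θ.Zt p.K).ζ0 0 Set.univ (pairCfg V1 Uf) *
          chiRegW F N (FluctV N) θ.ν θ.s2.cR p (gOfRecord₁₀ F N θ.toStage9Params p) 0 Set.univ (pairCfg V1 Uf) *
        (Real.exp (-(1 / 2 : ℝ) * (θ.Zt p.K).quad 0 ∅ (pairCfg V1 Uf)) *
          Real.exp ((sect2ActionDataOfRecord F N (FluctV N) p.K (settingOfRecord₁₂ F N θ p) (θ.Rz p.K) s t
            (fun _ => ∅, fun j => (pairCfg (V := FluctV N) V1 Uf j).2) Ek).action23 1 Uf)) := by
  rw [noExpIntegrand_WtOfRecord₁₂_sect2Operand, UbgOfRecord₁₂_one_pairCfg_of_Omega_empty θ p s hΩ V1 Uf hU]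

/-- **… AND IT VANISHES OFF THE p. 256 REGULAR SET** (the factor `χreg_0(T)(U) = 0`): the no-expansion integrand at the record is supported on the
`cR·ε₀`-regular fine fields, for every operand. [cite: Balaban1988Convergent, (2.10) p.256, (2.21) p.258] -/
theorem noExpIntegrand_WtOfRecord₁₂_eq_zero_of_chiRegW_eq_zero (Φ : SFluct (F.P p.K) (FluctV N) → MSField (F.P p.K) (SU N) → ℝ)
    (V1 : GaugeField (F.P p.K) 1 (SU N)) (Uf : GaugeField (F.P p.K) 0 (SU N))
    (h : chiRegW F N (FluctV N) θ.ν θ.s2.cR p (gOfRecord₁₀ F N θ.toStage9Params p) 0 Set.univ (pairCfg (V := FluctV N) V1 Uf) = 0) :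
    noExpIntegrand F N (FluctV N) p.K (WtOfRecord₁₂ F N θ p) Φ V1 Uf = 0 := by
  rw [WtOfRecord₁₂_eq, noExpIntegrand_tkWeightsOfRecord, h, mul_zero, zero_mul]

/-- **THE COHERENCE EQUATION'S RIGHT-HAND INTEGRAND ON THE REGULAR SET, WITH THE LETTERS' JUNCTION `cR·ε₀ ≤ ε₀^{reg}`**: wherever the regularity factor does
not vanish, the background of record is the fine field and the integrand is `ζ0_0(T)·χreg_0(T)·e^{−½quad_0(∅)}·exp A_1(s′)(U)` at `(U, V₁)`.
[cite: Balaban1988Convergent, (2.10) p.256, (2.12) p.256, (2.18) p.257, (2.21)–(2.23) p.258] -/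
theorem noExpIntegrand_WtOfRecord₁₂_sect2Operand_of_chiRegW_ne_zero (hc : θ.s2.cR * epsOfRecord θ.ν (gOfRecord₁₀ F N θ.toStage9Params p) 0 ≤
      θ.ν.εreg * (F.P p.K).eta 0 ^ 2)
    (s : SeqOfRecord F θ.ν θ.τ9.M (gOfRecord₁₀ F N θ.toStage9Params p) p.K 1) (hΩ : s.Ω 1 = ∅)
    (t : Sect2.TermValues (F.P p.K) (MatA N) (FluctV N) θ.τ9.M) (Ek : ℝ) (V1 : GaugeField (F.P p.K) 1 (SU N)) (Uf : GaugeField (F.P p.K) 0 (SU N))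
    (h : chiRegW F N (FluctV N) θ.ν θ.s2.cR p (gOfRecord₁₀ F N θ.toStage9Params p) 0 Set.univ (pairCfg (V := FluctV N) V1 Uf) ≠ 0) :
    noExpIntegrand F N (FluctV N) p.K (WtOfRecord₁₂ F N θ p)
        (sect2Operand F N (FluctV N) p.K (settingOfRecord₁₂ F N θ p) (θ.Rz p.K) s t Ek (UbgOfRecord₁₂ F N θ p 1 s)) V1 Uf =
      (θ.Zt p.K).ζ0 0 Set.univ (pairCfg V1 Uf) *
          chiRegW F N (FluctV N) θ.ν θ.s2.cR p (gOfRecord₁₀ F N θ.toStage9Params p) 0 Set.univ (pairCfg V1 Uf) *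
        (Real.exp (-(1 / 2 : ℝ) * (θ.Zt p.K).quad 0 ∅ (pairCfg V1 Uf)) *
          Real.exp ((sect2ActionDataOfRecord F N (FluctV N) p.K (settingOfRecord₁₂ F N θ p) (θ.Rz p.K) s t
            (fun _ => ∅, fun j => (pairCfg (V := FluctV N) V1 Uf j).2) Ek).action23 1 Uf)) :=
  noExpIntegrand_WtOfRecord₁₂_sect2Operand_of_regular θ p s hΩ t Ek V1 Uf (plaqSmall_of_chiRegW_zero_univ_ne_zero hc h)

end BackgroundAtAllLarge

end Literature.MathematicalPhysics.QuantumFieldTheory.Balaban1983to89.Node00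

end
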